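/-
Copyright (c) 2026 the pub-hodgecm-mathlib formalisation cell (harness21).  Prover seat hodgecm-mathlib-R90-C14-p04 (g0) (free R90-TF hand routed to L1 by
CHAIR VALVE WORD W4), Track B «K2-LIT» ∕ hLiu418 #184♮, Road I v3, unit U5 «THE CLOSE»: FACE-D₀ row `h2₂` «line lifts have rank ≤ 1» — §1 (B4) of the
census `R90/R90-C14-p04/g0/CENSUS-h22-LineLiftRankRow.R90-C14-p04-g0.md` (LEAD F0P6-plan (g14) BATCH #101 (3)).  THEOREMS ONLY.  2026-09-04.
-/
import Summits.HodgeConjecture.HodgeConjecture.Theorems.K2LiuLineThetaFunctionalOfRecord     -- ★ p862640 (K2Liu-p09 g8): `continuous_thetaFunctional`, `thetaFunctional_ratH_mul`; brings ★ U4 `doubledLineThetaLift_mul_right`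
import Summits.HodgeConjecture.HodgeConjecture.Theorems.K2LiuFourierCoeffDeltaContinuous      -- ★ `exists_bound_mul_of_unipDeltaRat_invariant`; brings ★ Φ1 `fourierCoeffDelta_unipDelta_mul`, ★ (c) `fourierCoeffDelta`
import HarnessLib

/-!
# K2_Liu road (hLiu418 = stmt-HodgeConjecture-24832), Road I v3, U5 «THE CLOSE», FACE-D₀ row `h2₂` «LINE LIFTS HAVE RANK ≤ 1», §1 (B4):
# the `S`-th FOURIER COEFFICIENT of the doubled line theta lift, read as a functional of `Φ`, is `(N_Δ(𝔸), ψ_S)`-QUASI-INVARIANT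

Cell `pub/hodgecm-mathlib` (D-0151), Track B, build stream 29; helper lane `--supports stmt-HodgeConjecture-24832 --as helper`, count-neutral.
THE ROW (★ p862586 `K2LiuFirstTermIdentityAssemblyDatumPrime` FACE-D′ :231–233): `∀ β hermitian, det β ≠ 0 → coeff β ∘ₗ codRestrict P T₂ hP₂ = 0` at the witnesses
OF RECORD `T₂ x h = Θ̃^□_{𝓣 x}(fw)(h)` (★ p862640) and `coeff β := cf (T_L⁻¹ β)`, `cf S := fourierCoeffDelta νN βw S` (K2Liu-p09 (g8) dictionary, 22:43:58Z):
«the `S`-th Fourier coefficient along the Siegel unipotent radical `N_Δ` of the doubled LINE theta lift vanishes identically for `det S ≠ 0`»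
([Rallis1984 §4]; [Kudla1986 Thm. 2.8]; [KudlaRallis1994 §3]: theta lifts from `U(⟨a′⟩)` carry only coefficients `β` represented by the line, `rank β ≤ 1`).
CENSUS VERDICT (memo cf04721eb7d416f7): ★ U2a (`K2LiuLineNoRankTwoCoinvariants(Herm)`) is the ABSTRACT LOCAL organ; the row is NOT a 40-line adapter over it —
the slot-`w` Schrödinger multiplier model of `pairRep|_{toDiagA(N_Δ,w)}` (B1) is not in the tree.  THIS FILE is brick (B4), ★-only:

* §1 **`fourierCoeffDelta_thetaLift_eq_at_one`** — `cf_S(Θ̃_Φ(fw))(h) = cf_S(Θ̃_{ω(toDiagA h, 1)Φ}(fw))(1)`: by ★ U4 `doubledLineThetaLift_mul_right`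
  (`Θ̃_Φ(fw)(u·h) = Θ̃_{ω(toDiagA h,1)Φ}(fw)(u)`) the coefficient at `h` is the coefficient at `1` of a Weil translate — so the row reduces to the values AT `1`.
* §1 **`fourierCoeffDelta_thetaLift_pairRep_unipDelta`** — THE QUASI-INVARIANCE: for `u₀ ∈ N_Δ(𝔸)`,
  `cf_S(Θ̃_{ω(toDiagA u₀, 1)Φ}(fw))(1) = ψ_S(u₀) · cf_S(Θ̃_Φ(fw))(1)`, i.e. the functional `Λ_S : Φ ↦ cf_S(Θ̃_Φ(fw))(1)` on `𝒮(𝔸^{n″})` satisfies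
  `Λ_S ∘ ω(toDiagA u₀, 1) = ψ_S(u₀) Λ_S` — §1 + ★ Φ1 `fourierCoeffDelta_unipDelta_mul` (`φ_S(u₀ h) = ψ_S(u₀) φ_S(h)`), whose hypotheses (continuity, boundedness
  along `N_Δ(𝔸)`, left-`N_Δ(L⁺)`-invariance of `Θ̃_Φ(fw)`) are ★ p862640 `continuous_thetaFunctional` ∕ `thetaFunctional_ratH_mul` + ★
  `exists_bound_mul_of_unipDeltaRat_invariant` (continuity + cocompactness of `N_Δ(L⁺)` in `N_Δ(𝔸)`).
* §2 **`coeff_comp_codRestrict_thetaFunctional_eq_zero`** — THE ROW SHAPE, HYPOTHESIS-FIRST on the one remaining letter: for any class `P`, any linear `cfS : ↥P →ₗ (H(𝔸) → ℂ)`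
  agreeing with `fourierCoeffDelta νN βw S` on `P` (★ (c)), any domain `D`, carrier `𝓣`, and `T₂` with the law `hT₂B` and `hP₂ : ∀ x, T₂ x ∈ P`:
  IF `Λ_S ≡ 0` (`hΛ : ∀ Φ, cf_S(Θ̃_Φ(fw))(1) = 0` — the content of U2a at one finite place through (B1)(B2)(B3)(B5) of the census, BY VALUE) THEN
  `cfS ∘ₗ LinearMap.codRestrict P T₂ hP₂ = 0` — the bytes of `h2₂` at `coeff β := cfS` for `S := T_L⁻¹ β`.

No definition, no instance, no notation, no named-fact hypothesis, no `sorry`; axioms ⊆ {propext, Classical.choice, Quot.sound}.  HONEST LABEL: HC_CM is proved only modulo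
the 7 printed citations (2 remaining named inputs: hLiu418 = stmt-HodgeConjecture-24832, h413 = stmt-HodgeConjecture-24833) until rung 0 closes; this file moves no counter
(it reduces row `h2₂` to the vanishing of ONE quasi-invariant functional; (B1) stays by value).

References: [Rallis1984] S. Rallis, *On the Howe duality conjecture*, Compositio Math. 51 (1984) §4; [Kudla1986] S. S. Kudla, Invent. Math. 83 (1986) Thm. 2.8;
[KudlaRallis1994] S. Kudla, S. Rallis, Ann. of Math. 140 (1994) §3; [MoeglinWaldspurger1995] C. Mœglin, J.-L. Waldspurger, CUP (1995) I.2.6; [Weil1964] A. Weil, Acta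
Math. 111 (1964) Chap. III n° 41 Thm 6 p. 193; [Liu2021] Y. Liu, Camb. J. Math. 9 (2021) App. B (B.7), Prop. B.8 p. 104.
-/

set_option autoImplicit false
set_option linter.dupNamespace false
-- statements over the adelic dual-pair carriers elaborate to very large types; elaborate sequentially (as in ★ `K2LiuLineThetaFunctionalOfRecord`)
set_option Elab.async false

noncomputable section

open NumberField MeasureTheory IsDedekindDomain
open scoped Matrix ComplexOrder ENNReal

namespace Summit.HodgeConjecture.HodgeConjecture.Cruxes.HLiu418.K2LiuFirstTermLineLiftRankRow

open Literature.NumberTheory.Automorphic Literature.NumberTheory.Automorphic.UnitaryGroup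
open Literature.NumberTheory.Automorphic.IdeleClassGroup
open Literature.NumberTheory.Automorphic.Liu2021
open Literature.NumberTheory.Automorphic.Liu2021.Def411WeilCarriers
open Literature.NumberTheory.Automorphic.Liu2021.Def411WeilCarriersDoubling
open Literature.NumberTheory.GelbartRogawski1991 Literature.NumberTheory.GelbartRogawski1991.UnitaryDualPair
open Literature.NumberTheory.GelbartRogawski1991.GRConstruction
open Literature.NumberTheory.GaloisRepresentations
open Literature.NumberTheory.Weil1964
open Literature.RepresentationTheory.Liu2021
open Literature.NumberTheory.K2Lit.DoubledLineTheta Literature.NumberTheory.K2Lit.SiegelDoubled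
open Literature.MeasureTheory.Group
open Summit.HodgeConjecture.HodgeConjecture.Cruxes.HLiu418.K2LiuSiegelUnipotentFourierDefs
open Summit.HodgeConjecture.HodgeConjecture.Cruxes.HLiu418.K2LiuSiegelUnipotentCharacters
open Summit.HodgeConjecture.HodgeConjecture.Cruxes.HLiu418.K2LiuUnipotentCoveringWeight
open Summit.HodgeConjecture.HodgeConjecture.Cruxes.HLiu418.K2LiuSiegelFourierCoeffDelta (fourierCoeffDelta_unipDelta_mul)
open Summit.HodgeConjecture.HodgeConjecture.Cruxes.HLiu418.K2LiuFourierCoeffDeltaContinuous (exists_bound_mul_of_unipDeltaRat_invariant)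
open Summit.HodgeConjecture.HodgeConjecture.Cruxes.HLiu418.K2LiuLineThetaFactorsThroughCoinvariants (doubledLineThetaLift_mul_right)
open Summit.HodgeConjecture.HodgeConjecture.Cruxes.HLiu418.K2LiuDoubledLineThetaAutomorphic (doubledLineThetaLift_ratH_mul)
open Summit.HodgeConjecture.HodgeConjecture.Cruxes.HLiu418.K2LiuLineThetaFunctionalOfRecord (continuous_thetaFunctional)

variable (L : Type) [Field L] [NumberField L] [IsCMField L]
variable {N n : ℕ} (e : Fin N × Fin 1 ≃ Fin n)
  (dV : Fin N → L) (hdV : ∀ i, IsCMField.complexConj L (dV i) = dV i)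
  (dW : Fin 1 → L) (hdW : ∀ i, IsCMField.complexConj L (dW i) = dW i)
  {n'' : ℕ} (e₁ : Fin (n + n) × Fin 1 ≃ Fin n'')
  (hdV0 : ∀ i, dV i ≠ 0) (hdW0 : ∀ i, dW i ≠ 0)
  (lam : IdeleClassGroup L →ₜ* Circle) (hlam : IsConjugateSymplectic L lam) (a' : (Fp L)ˣ)
  (hρ : HasThetaMajorants fun
      (p : ↥(UnitaryGroup.adelic (Fp L) L (IsCMField.complexConj L) (n + n) (Matrix.diagonal (dD L e dV hdV dW hdW))) ×
        ↥(UnitaryGroup.adelic (Fp L) L (IsCMField.complexConj L) 1 (JW (Fp L) L a')))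
      (Φ : piSchwartzBruhat (Fp L) (Fin n'')) =>
        pairRep (Fp L) L (IsCMField.complexConj L) (n + n) 1 e₁ (Matrix.diagonal (dD L e dV hdV dW hdW)) (JW (Fp L) L a')
          (chiSplittingLine L e₁ (dD L e dV hdV dW hdW) (dD_conj L e dV hdV dW hdW) (dD_ne_zero L e dV hdV dW hdW hdV0 hdW0)
            (toHeckeCharacter L lam) (isUnitary_toHeckeCharacter L lam)
            ((isOscillatorChar_toHeckeCharacter_iff lam).mpr hlam) (TW (Fp L) a')
            (isUnit_det_TW (Fp L) a') (JW (Fp L) L a') (JW_eq (Fp L) L a'))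
          p Φ)
  [MeasurableSpace (↥(UnitaryGroup.adelic (Fp L) L (IsCMField.complexConj L) 1 (JW (Fp L) L a')) ⧸
    (UnitaryGroup.toAdelic (Fp L) L (IsCMField.complexConj L) 1 (JW (Fp L) L a')).range)]
  [BorelSpace (↥(UnitaryGroup.adelic (Fp L) L (IsCMField.complexConj L) 1 (JW (Fp L) L a')) ⧸
    (UnitaryGroup.toAdelic (Fp L) L (IsCMField.complexConj L) 1 (JW (Fp L) L a')).range)]
  (μW : Measure (↥(UnitaryGroup.adelic (Fp L) L (IsCMField.complexConj L) 1 (JW (Fp L) L a')) ⧸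
    (UnitaryGroup.toAdelic (Fp L) L (IsCMField.complexConj L) 1 (JW (Fp L) L a')).range)) [IsFiniteMeasure μW]
  (fw : C(↥(UnitaryGroup.adelic (Fp L) L (IsCMField.complexConj L) 1 (JW (Fp L) L a')) ⧸
    (UnitaryGroup.toAdelic (Fp L) L (IsCMField.complexConj L) 1 (JW (Fp L) L a')).range, ℂ))
  [MeasurableSpace (unipDelta L e dV hdV dW hdW)] [BorelSpace (unipDelta L e dV hdV dW hdW)]
  (νN : Measure (unipDelta L e dV hdV dW hdW))
  (βw : unipDelta L e dV hdV dW hdW → ℝ≥0∞) (S : Matrix (Fin n) (Fin n) L)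

/-! ## §1 The coefficient at `h` is the coefficient at `1` of a Weil translate; quasi-invariance under `N_Δ(𝔸)` -/

omit [BorelSpace (↥(UnitaryGroup.adelic (Fp L) L (IsCMField.complexConj L) 1 (JW (Fp L) L a')) ⧸
    (UnitaryGroup.toAdelic (Fp L) L (IsCMField.complexConj L) 1 (JW (Fp L) L a')).range)] [IsFiniteMeasure μW]
  [BorelSpace (unipDelta L e dV hdV dW hdW)] in
set_option maxHeartbeats 1000000 in -- the theta-kernel datum's statement telescope (as ★ U4 `doubledLineThetaLift_mul_right`)
/-- **`cf_S(Θ̃_Φ(fw))(h) = cf_S(Θ̃_{ω(toDiagA h, 1)Φ}(fw))(1)`**: the `S`-th Fourier coefficient along `N_Δ` of the doubled line theta lift at `h` is the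
coefficient AT `1` of the lift of the Weil translate `ω(toDiagA h, 1)Φ` (★ U4 `doubledLineThetaLift_mul_right`: `Θ̃_Φ(fw)(u·h) = Θ̃_{ω(toDiagA h,1)Φ}(fw)(u)`
under the integral sign; no hypothesis on `νN`, `βw`).  (`maxHeartbeats 1000000`: the theta-kernel datum's statement telescope, measured as in ★ U4.)
[cite: Weil1964, Chap. III n° 41 Thm 6 p. 193] [cite: MoeglinWaldspurger1995, I.2.6] -/
theorem fourierCoeffDelta_thetaLift_eq_at_one (Φ : piSchwartzBruhat (Fp L) (Fin n'')) (h : HA L e dV hdV dW hdW) :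
    fourierCoeffDelta L e dV hdV dW hdW νN βw S (doubledLineThetaLift L e dV hdV dW hdW e₁ hdV0 hdW0 lam hlam a' hρ μW Φ fw) h =
      fourierCoeffDelta L e dV hdV dW hdW νN βw S
        (doubledLineThetaLift L e dV hdV dW hdW e₁ hdV0 hdW0 lam hlam a' hρ μW
          (pairRep (Fp L) L (IsCMField.complexConj L) (n + n) 1 e₁ (Matrix.diagonal (dD L e dV hdV dW hdW)) (JW (Fp L) L a')
            (chiSplittingLine L e₁ (dD L e dV hdV dW hdW) (dD_conj L e dV hdV dW hdW) (dD_ne_zero L e dV hdV dW hdW hdV0 hdW0)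
              (toHeckeCharacter L lam) (isUnitary_toHeckeCharacter L lam)
              ((isOscillatorChar_toHeckeCharacter_iff lam).mpr hlam) (TW (Fp L) a')
              (isUnit_det_TW (Fp L) a') (JW (Fp L) L a') (JW_eq (Fp L) L a'))
            (toDiagA L e dV hdV dW hdW h, 1) Φ) fw) 1 := by
  rw [fourierCoeffDelta_def, fourierCoeffDelta_def]
  congr 1
  refine integral_congr_ae (Filter.Eventually.of_forall fun u => ?_)
  beta_reduce
  rw [mul_one, doubledLineThetaLift_mul_right]

omit [BorelSpace (↥(UnitaryGroup.adelic (Fp L) L (IsCMField.complexConj L) 1 (JW (Fp L) L a')) ⧸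
    (UnitaryGroup.toAdelic (Fp L) L (IsCMField.complexConj L) 1 (JW (Fp L) L a')).range)] [IsFiniteMeasure μW]
  [MeasurableSpace (unipDelta L e dV hdV dW hdW)] [BorelSpace (unipDelta L e dV hdV dW hdW)] in
/-- **`Θ̃_Φ(fw)` is left-`N_Δ(L⁺)`-invariant** (`N_Δ(L⁺) ≤ H(L⁺)`, ★ `doubledLineThetaLift_ratH_mul`). [cite: Weil1964, Chap. III n° 41 Thm 6 p. 193] -/
theorem doubledLineThetaLift_unipDeltaRat_mul (Φ : piSchwartzBruhat (Fp L) (Fin n'')) (γ : unipDeltaRat L e dV hdV dW hdW) (x : HA L e dV hdV dW hdW) :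
    doubledLineThetaLift L e dV hdV dW hdW e₁ hdV0 hdW0 lam hlam a' hρ μW Φ fw (((γ : unipDelta L e dV hdV dW hdW) : HA L e dV hdV dW hdW) * x) =
      doubledLineThetaLift L e dV hdV dW hdW e₁ hdV0 hdW0 lam hlam a' hρ μW Φ fw x :=
  doubledLineThetaLift_ratH_mul L e dV hdV dW hdW e₁ hdV0 hdW0 lam hlam a' hρ μW Φ fw
    ⟨((γ : unipDelta L e dV hdV dW hdW) : HA L e dV hdV dW hdW), (mem_unipDeltaRat_iff L e dV hdV dW hdW _).1 γ.2⟩ x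

set_option maxHeartbeats 1000000 in -- idem
/-- **QUASI-INVARIANCE OF THE COEFFICIENT FUNCTIONAL UNDER `N_Δ(𝔸)`** (brick (B4) of the `h2₂` census): for `u₀ ∈ N_Δ(𝔸)`, `νN` left-invariant and `βw` an
`N_Δ(L⁺)`-covering weight of finite mass, `cf_S(Θ̃_{ω(toDiagA u₀, 1)Φ}(fw))(1) = ψ_S(u₀) · cf_S(Θ̃_Φ(fw))(1)` — the functional `Λ_S : Φ ↦ cf_S(Θ̃_Φ(fw))(1)` on
`𝒮(𝔸^{n″})` is `(N_Δ(𝔸), ψ_S)`-quasi-invariant through `ω ∘ toDiagA`.  Proof: §1 `…_eq_at_one` backwards puts the left side at `h = u₀`, and ★ Φ1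
`fourierCoeffDelta_unipDelta_mul` (`φ_S(u₀·1) = ψ_S(u₀) φ_S(1)`) applies to `φ = Θ̃_Φ(fw)`: continuous (★ p862640 `continuous_thetaFunctional`), left-`N_Δ(L⁺)`-invariant
(`doubledLineThetaLift_unipDeltaRat_mul`), bounded along `N_Δ(𝔸)` (★ `exists_bound_mul_of_unipDeltaRat_invariant`).  With U2a at one finite place (census (B1)–(B5),
not here) a continuous `(N_Δ(𝔸), ψ_S)`-quasi-invariant functional vanishes for `det S ≠ 0`. [cite: Rallis1984, §4] [cite: KudlaRallis1994, §3] [cite: MoeglinWaldspurger1995, I.2.6] -/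
theorem fourierCoeffDelta_thetaLift_pairRep_unipDelta [νN.IsMulLeftInvariant]
    (hβ : IsCoveringWeight (unipDeltaRat L e dV hdV dW hdW) βw) (hβtop : ∫⁻ u, βw u ∂νN ≠ ∞)
    (Φ : piSchwartzBruhat (Fp L) (Fin n'')) (u₀ : unipDelta L e dV hdV dW hdW) :
    fourierCoeffDelta L e dV hdV dW hdW νN βw S
        (doubledLineThetaLift L e dV hdV dW hdW e₁ hdV0 hdW0 lam hlam a' hρ μW
          (pairRep (Fp L) L (IsCMField.complexConj L) (n + n) 1 e₁ (Matrix.diagonal (dD L e dV hdV dW hdW)) (JW (Fp L) L a')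
            (chiSplittingLine L e₁ (dD L e dV hdV dW hdW) (dD_conj L e dV hdV dW hdW) (dD_ne_zero L e dV hdV dW hdW hdV0 hdW0)
              (toHeckeCharacter L lam) (isUnitary_toHeckeCharacter L lam)
              ((isOscillatorChar_toHeckeCharacter_iff lam).mpr hlam) (TW (Fp L) a')
              (isUnit_det_TW (Fp L) a') (JW (Fp L) L a') (JW_eq (Fp L) L a'))
            (toDiagA L e dV hdV dW hdW (u₀ : HA L e dV hdV dW hdW), 1) Φ) fw) 1 =
      (unipDeltaChar L e dV hdV dW hdW S (u₀ : HA L e dV hdV dW hdW) : ℂ) *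
        fourierCoeffDelta L e dV hdV dW hdW νN βw S (doubledLineThetaLift L e dV hdV dW hdW e₁ hdV0 hdW0 lam hlam a' hρ μW Φ fw) 1 := by
  -- the lift `φ := Θ̃_Φ(fw)` and its three regularity properties
  have hcont : Continuous (doubledLineThetaLift L e dV hdV dW hdW e₁ hdV0 hdW0 lam hlam a' hρ μW Φ fw) :=
    continuous_thetaFunctional L e dV hdV dW hdW e₁ hdV0 hdW0 lam hlam a' hρ μW fw (LinearMap.id : piSchwartzBruhat (Fp L) (Fin n'') →ₗ[ℂ] _)
      (T₂ := fun Ψ => doubledLineThetaLift L e dV hdV dW hdW e₁ hdV0 hdW0 lam hlam a' hρ μW Ψ fw) (fun _ _ => rfl) Φ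
  have hinv := doubledLineThetaLift_unipDeltaRat_mul L e dV hdV dW hdW e₁ hdV0 hdW0 lam hlam a' hρ μW fw Φ
  have hφc : Continuous fun u : unipDelta L e dV hdV dW hdW =>
      doubledLineThetaLift L e dV hdV dW hdW e₁ hdV0 hdW0 lam hlam a' hρ μW Φ fw ((u : HA L e dV hdV dW hdW) * 1) :=
    hcont.comp (continuous_subtype_val.mul continuous_const)
  have hφb := exists_bound_mul_of_unipDeltaRat_invariant L e dV hdV dW hdW hdV0 hdW0 hcont hinv 1
  have hφ : ∀ (γ : unipDeltaRat L e dV hdV dW hdW) (u : unipDelta L e dV hdV dW hdW),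
      doubledLineThetaLift L e dV hdV dW hdW e₁ hdV0 hdW0 lam hlam a' hρ μW Φ fw
          ((((γ : unipDelta L e dV hdV dW hdW) * u : unipDelta L e dV hdV dW hdW) : HA L e dV hdV dW hdW) * 1) =
        doubledLineThetaLift L e dV hdV dW hdW e₁ hdV0 hdW0 lam hlam a' hρ μW Φ fw ((u : HA L e dV hdV dW hdW) * 1) := fun γ u => by
    rw [Subgroup.coe_mul, mul_assoc, hinv]
  have h1 := fourierCoeffDelta_thetaLift_eq_at_one L e dV hdV dW hdW e₁ hdV0 hdW0 lam hlam a' hρ μW fw νN βw S Φ (u₀ : HA L e dV hdV dW hdW)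
  have key := fourierCoeffDelta_unipDelta_mul L e dV hdV dW hdW νN hβ hβtop S hφc hφb hφ u₀
  rw [mul_one] at key
  rw [← h1]
  exact key

/-! ## §2 The row `h2₂`, hypothesis-first on the vanishing of the quasi-invariant functional `Λ_S` -/

omit [BorelSpace (↥(UnitaryGroup.adelic (Fp L) L (IsCMField.complexConj L) 1 (JW (Fp L) L a')) ⧸
    (UnitaryGroup.toAdelic (Fp L) L (IsCMField.complexConj L) 1 (JW (Fp L) L a')).range)] [IsFiniteMeasure μW]
  [BorelSpace (unipDelta L e dV hdV dW hdW)] in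
set_option maxHeartbeats 1000000 in -- idem
/-- **ROW `h2₂` AT THE WITNESSES OF RECORD, modulo `Λ_S ≡ 0`.**  Let `P` be any class of functions on `H(𝔸)`, `cfS : ↥P →ₗ (H(𝔸) → ℂ)` any linear map that IS the
`S`-th Fourier coefficient on `P` (`hcf`, ★ (c)'s linear reading), `T₂ : D →ₗ (H(𝔸) → ℂ)` the line theta functional of a carrier `𝓣` (`hT₂B`, ★ p862640) with values in
`P` (`hP₂`).  IF the coefficient functional at `1` vanishes on all of `𝒮(𝔸^{n″})` (`hΛ` — for `det S ≠ 0` this is U2a at one finite place, census (B1)–(B5), BY VALUE here)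
THEN `cfS ∘ₗ codRestrict P T₂ hP₂ = 0` — the bytes of FACE-D′'s `h2₂` at `coeff β := cfS`, `S := T_L⁻¹β` (§1 `…_eq_at_one` moves every `h` to `1`).
[cite: Rallis1984, §4] [cite: Kudla1986, Thm. 2.8] [cite: KudlaRallis1994, §3] [cite: Liu2021, App. B Prop. B.8 p. 104] -/
theorem coeff_comp_codRestrict_thetaFunctional_eq_zero
    (P : Submodule ℂ (HA L e dV hdV dW hdW → ℂ)) (cfS : ↥P →ₗ[ℂ] (HA L e dV hdV dW hdW → ℂ))
    (hcf : ∀ (y : ↥P) (h : HA L e dV hdV dW hdW), cfS y h = fourierCoeffDelta L e dV hdV dW hdW νN βw S (y : HA L e dV hdV dW hdW → ℂ) h)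
    {D : Type*} [AddCommGroup D] [Module ℂ D] (𝓣 : D →ₗ[ℂ] piSchwartzBruhat (Fp L) (Fin n''))
    (T₂ : D →ₗ[ℂ] (HA L e dV hdV dW hdW → ℂ))
    (hT₂B : ∀ (x : D) (h : HA L e dV hdV dW hdW),
      T₂ x h = doubledLineThetaLift L e dV hdV dW hdW e₁ hdV0 hdW0 lam hlam a' hρ μW (𝓣 x) fw h)
    (hP₂ : ∀ x, T₂ x ∈ P)
    (hΛ : ∀ Φ : piSchwartzBruhat (Fp L) (Fin n''),
      fourierCoeffDelta L e dV hdV dW hdW νN βw S (doubledLineThetaLift L e dV hdV dW hdW e₁ hdV0 hdW0 lam hlam a' hρ μW Φ fw) 1 = 0) :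
    cfS ∘ₗ LinearMap.codRestrict P T₂ hP₂ = 0 := by
  refine LinearMap.ext fun x => funext fun h => ?_
  have hTx : ((LinearMap.codRestrict P T₂ hP₂ x : ↥P) : HA L e dV hdV dW hdW → ℂ) =
      doubledLineThetaLift L e dV hdV dW hdW e₁ hdV0 hdW0 lam hlam a' hρ μW (𝓣 x) fw := by
    rw [LinearMap.codRestrict_apply]
    exact funext (hT₂B x)
  rw [LinearMap.comp_apply, LinearMap.zero_apply, Pi.zero_apply, hcf, hTx, fourierCoeffDelta_thetaLift_eq_at_one, hΛ]

end Summit.HodgeConjecture.HodgeConjecture.Cruxes.HLiu418.K2LiuFirstTermLineLiftRankRow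

end
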